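import Summits.SmoothPoincare4.SmoothPoincare4.Theses.CylinderEntropy
import Literature.Geometry.Riemannian.SphericalCylinderEntropy
import Literature.Geometry.Manifold.CylinderSlice
import Literature.Topology.FourManifolds.CerfGammaFourProofs
import Literature.Topology.FourManifolds.HomotopyS4CompactProofs
import HarnessLib

/-!
# `CylinderEntropy.RungTwoOfSliceIsolation` reduced to ENTROPY DESCENT (support item stmt-SmoothPoincare4-14765)

The support item `RungTwoOfSliceIsolation := SliceIsolation → CylinderRungTwo` of route `CylinderEntropy`
(the second path `SliceIsolation ∧ RungTwoOfSliceIsolation ⇒ CylinderRungTwo` to the rank-2 hypothesis of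
the deciding theorem `closes`).  Written out, the item is `(∃ ε > 0, Rung (1+ε)) → Rung (4/e)`, where
`Rung c` = "every end-separating cross-section embedding of a homotopy 4-sphere into `N = S⁴ × ℝ ⊂ ℝ⁶`
with typed cylinder entropy `< c` has `M ≃ₘ S⁴`".  Because the `ε` of `SliceIsolation` is existential
(unknown), the item asks, for EVERY `ε > 0`, to push a thin cross-section of `M` (entropy `< 4/e`) down to
a cross-section OF THE SAME `M` with entropy `< 1 + ε` — the planner's steps (1) FINITE-TIME HALF (mean
curvature flow with surgery in `N`, the open Chodosh–Mantoulidis–Schulze port; registered stub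
`stub_finiteTimeHalf` of line `killing-flux` / `stub_densityDropPort` + `stub_tameSurgeryStructure` of line
`proxy-models-below-bubble-sheet` on crux stmt-SmoothPoincare4-7631) and (2) RELAXATION `λ_cyl(F_t) → 1`
(`stub_relaxation` / `stub_relaxationToSlice`, ibid.).  We call their flow-free conjunction ENTROPY
DESCENT; it is spelled out verbatim as a hypothesis below (no definition is introduced) in the tree's
vocabulary (`SphericalCylinderEntropy.cylEntropy` IS the items' `⨆`, definitionally).

What is kernel-checked here (pure logic over the tree; nothing open is asserted):

* `rungTwoOfSliceIsolation_of_entropyDescent` — STEP (3) of the intended proof: ENTROPY DESCENT ⇒ the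
  item (pick the `ε` of `SliceIsolation`, descend below `1 + ε`, apply `SliceIsolation` to the new
  cross-section of the same `M`).  This is the exact residual: once stubs (1)+(2) of crux 7631 land in
  any typing, the item closes by instantiating `hdesc` (take `ι' := F t₀`).
* `rungTwoOfSliceIsolation_of_entropyDescent'` — the same with the descended cross-section allowed to
  live on ANY manifold `M'` diffeomorphic to `M` (the natural output of a surgery flow: the root
  component `≅ M # S⁴ # ⋯ # S⁴ ≅ M`), transporting `M ≃ₕ S⁴` along the diffeomorphism.
* `rungTwoOfSliceIsolation_of_cylinderRungTwo` — the item is implied outright by the crux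
  `CylinderRungTwo` (so it is true if SPC4 is), and `smoothPoincare4_of_secondPath` — the second path
  assembles: `SliceIsolation → RungTwoOfSliceIsolation → ThinCrossSectionExists → SmoothPoincare4`.
* `entropyDescent_of_cylinderRungTwo` — conversely the crux plus the calibration item `SliceCalibration`
  (`λ_cyl(slice) = 1`) give ENTROPY DESCENT (transport the slice along `M ≃ₘ S⁴`, as in the crux's
  Negative lemma `exists_thinCrossSection_of_diffeomorph`, re-derived here from `CylinderSlice`); hence
  `cylinderRungTwo_iff_entropyDescent`: modulo the two lower items `SliceIsolation`, `SliceCalibration`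
  of the route, ENTROPY DESCENT ↔ `CylinderRungTwo` ↔ this item — the support item carries exactly the
  open content of the crux minus rung-0 recognition, no less.
* `entropyDescent_of_flow`, `rungTwoOfSliceIsolation_of_flow` — the flow interface: for an ARBITRARY flow
  predicate `Flow M F ν T` whose flows consist of smooth embeddings into `N`, hypotheses of the exact shapes
  of `stub_finiteTimeHalf` (minus its slab clause) and `stub_relaxation` of line `killing-flux` give ENTROPY
  DESCENT and hence the item; with `Flow := IsCylinderMCF` the item is closed modulo those two registered
  stubs of crux 7631 (`4/e ≤ 2`; `M` compact and connected from `M ≃ₕ S⁴`, tree theorems).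

NOT here: any flow, any analysis; the descent itself is the open finite-time half of crux 7631 and is
staffed through that crux's lines.  Helpers only (`--supports stmt-SmoothPoincare4-14765`). [folklore]
-/

noncomputable section

-- the registered namespace `Summit.SmoothPoincare4.SmoothPoincare4.Theorems…` repeats a component
set_option linter.dupNamespace false

open MeasureTheory Set
open scoped Manifold ContDiff ENNReal Topology BigOperators ContinuousMap

namespace Summit.SmoothPoincare4.SmoothPoincare4.Theorems.CylinderEntropyRungTwoOfSliceIsolation

open Literature.Geometry.Riemannian.SphericalCylinderEntropy (cylEntropy)
open Literature.Geometry.Manifold.CylinderSlice (sliceMap range_sliceMap isSmoothEmbedding_sliceMap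
  sum_sq_sliceMap separatesEnds_of_slice_subset)
open Summit.SmoothPoincare4.SmoothPoincare4.Theses.CylinderEntropy

/-! ### Step (3): entropy descent on the same `M` lifts `SliceIsolation` to rung 2 -/

/-- **ENTROPY DESCENT ⇒ `RungTwoOfSliceIsolation`** (step (3) of the planner's proof, kernel-checked).
Hypothesis `hdesc` (ENTROPY DESCENT, flow-free form of "finite-time half + relaxation"): for every
homotopy 4-sphere `M`, every end-separating smooth cross-section embedding `ι : M → N` with typed cylinder
entropy `< 4/e`, and every `ε > 0`, there is an end-separating smooth cross-section embedding `ι'` OF THE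
SAME `M` with entropy `< 1 + ε`.  Conclusion: `SliceIsolation → CylinderRungTwo` — fix the universal `ε`
of `SliceIsolation`, descend below `1 + ε`, and apply `SliceIsolation` to `ι'`. [folklore] -/
theorem rungTwoOfSliceIsolation_of_entropyDescent
    (hdesc : ∀ (M : Type) [TopologicalSpace M] [T2Space M] [SecondCountableTopology M]
        [ChartedSpace (EuclideanSpace ℝ (Fin 4)) M] [IsManifold (𝓡 4) ∞ M],
        M ≃ₕ Metric.sphere (0 : EuclideanSpace ℝ (Fin 5)) 1 →
        ∀ ι : M → EuclideanSpace ℝ (Fin 6), Manifold.IsSmoothEmbedding (𝓡 4) (𝓡 6) ∞ ι →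
        (∀ x, ∑ i : Fin 5, ι x (Fin.castSucc i) ^ 2 = 1) →
        (∃ R : ℝ, ∀ a b : EuclideanSpace ℝ (Fin 6), ∑ i : Fin 5, a (Fin.castSucc i) ^ 2 = 1 →
          ∑ i : Fin 5, b (Fin.castSucc i) ^ 2 = 1 → a 5 ≤ -R → R ≤ b 5 →
          ¬ JoinedIn ({z : EuclideanSpace ℝ (Fin 6) | ∑ i : Fin 5, z (Fin.castSucc i) ^ 2 = 1} \
            Set.range ι) a b) →
        cylEntropy (Set.range ι) < ENNReal.ofReal (4 / Real.exp 1) →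
        ∀ ε : ℝ, 0 < ε →
          ∃ ι' : M → EuclideanSpace ℝ (Fin 6), Manifold.IsSmoothEmbedding (𝓡 4) (𝓡 6) ∞ ι' ∧
            (∀ x, ∑ i : Fin 5, ι' x (Fin.castSucc i) ^ 2 = 1) ∧
            (∃ R : ℝ, ∀ a b : EuclideanSpace ℝ (Fin 6), ∑ i : Fin 5, a (Fin.castSucc i) ^ 2 = 1 →
              ∑ i : Fin 5, b (Fin.castSucc i) ^ 2 = 1 → a 5 ≤ -R → R ≤ b 5 →
              ¬ JoinedIn ({z : EuclideanSpace ℝ (Fin 6) | ∑ i : Fin 5, z (Fin.castSucc i) ^ 2 = 1} \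
                Set.range ι') a b) ∧
            cylEntropy (Set.range ι') < ENNReal.ofReal (1 + ε)) :
    RungTwoOfSliceIsolation := by
  intro hiso M _ _ _ _ _ e ι hι hN hsep hent
  obtain ⟨ε, hε, hreg⟩ := hiso
  obtain ⟨ι', hι', hN', hsep', hent'⟩ := hdesc M e ι hι hN hsep hent ε hε
  exact hreg M e ι' hι' hN' hsep' hent'

/-- **ENTROPY DESCENT UP TO DIFFEOMORPHISM ⇒ `RungTwoOfSliceIsolation`.**  The same reduction when the
descended cross-section is an embedding of ANY `4`-manifold `M'` diffeomorphic to `M` (the natural output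
of a mean curvature flow with surgery: the immortal root component, `≅ M # S⁴ # ⋯ # S⁴ ≅ M`): `M'` is
again a homotopy 4-sphere (transport `M ≃ₕ S⁴` along the diffeomorphism), `SliceIsolation` gives
`M' ≃ₘ S⁴`, and `M ≃ₘ M' ≃ₘ S⁴`. [folklore] -/
theorem rungTwoOfSliceIsolation_of_entropyDescent'
    (hdesc : ∀ (M : Type) [TopologicalSpace M] [T2Space M] [SecondCountableTopology M]
        [ChartedSpace (EuclideanSpace ℝ (Fin 4)) M] [IsManifold (𝓡 4) ∞ M],
        M ≃ₕ Metric.sphere (0 : EuclideanSpace ℝ (Fin 5)) 1 →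
        ∀ ι : M → EuclideanSpace ℝ (Fin 6), Manifold.IsSmoothEmbedding (𝓡 4) (𝓡 6) ∞ ι →
        (∀ x, ∑ i : Fin 5, ι x (Fin.castSucc i) ^ 2 = 1) →
        (∃ R : ℝ, ∀ a b : EuclideanSpace ℝ (Fin 6), ∑ i : Fin 5, a (Fin.castSucc i) ^ 2 = 1 →
          ∑ i : Fin 5, b (Fin.castSucc i) ^ 2 = 1 → a 5 ≤ -R → R ≤ b 5 →
          ¬ JoinedIn ({z : EuclideanSpace ℝ (Fin 6) | ∑ i : Fin 5, z (Fin.castSucc i) ^ 2 = 1} \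
            Set.range ι) a b) →
        cylEntropy (Set.range ι) < ENNReal.ofReal (4 / Real.exp 1) →
        ∀ ε : ℝ, 0 < ε →
          ∃ (M' : Type) (_ : TopologicalSpace M') (_ : T2Space M') (_ : SecondCountableTopology M')
            (_ : ChartedSpace (EuclideanSpace ℝ (Fin 4)) M') (_ : IsManifold (𝓡 4) ∞ M'),
            Nonempty (M ≃ₘ⟮𝓡 4, 𝓡 4⟯ M') ∧
            ∃ ι' : M' → EuclideanSpace ℝ (Fin 6), Manifold.IsSmoothEmbedding (𝓡 4) (𝓡 6) ∞ ι' ∧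
              (∀ x, ∑ i : Fin 5, ι' x (Fin.castSucc i) ^ 2 = 1) ∧
              (∃ R : ℝ, ∀ a b : EuclideanSpace ℝ (Fin 6), ∑ i : Fin 5, a (Fin.castSucc i) ^ 2 = 1 →
                ∑ i : Fin 5, b (Fin.castSucc i) ^ 2 = 1 → a 5 ≤ -R → R ≤ b 5 →
                ¬ JoinedIn ({z : EuclideanSpace ℝ (Fin 6) | ∑ i : Fin 5, z (Fin.castSucc i) ^ 2 = 1} \
                  Set.range ι') a b) ∧
              cylEntropy (Set.range ι') < ENNReal.ofReal (1 + ε)) :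
    RungTwoOfSliceIsolation := by
  intro hiso M _ _ _ _ _ e ι hι hN hsep hent
  obtain ⟨ε, hε, hreg⟩ := hiso
  obtain ⟨M', _, _, _, _, _, ⟨d⟩, ι', hι', hN', hsep', hent'⟩ := hdesc M e ι hι hN hsep hent ε hε
  have e' : M' ≃ₕ Metric.sphere (0 : EuclideanSpace ℝ (Fin 5)) 1 :=
    d.symm.toHomeomorph.toHomotopyEquiv.trans e
  obtain ⟨d'⟩ := hreg M' e' ι' hι' hN' hsep' hent'
  exact ⟨d.trans d'⟩

/-! ### The sandwich: crux ⇒ item, and the second path to the summit -/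

/-- **The crux implies the support item outright**: `CylinderRungTwo → (SliceIsolation → CylinderRungTwo)`
(discard the hypothesis).  In particular the item is true if SPC4 is (tree: `SPC4 → CylinderRungTwo`),
and it is not refutable short of an exotic 4-sphere (`¬item ↔ SliceIsolation ∧ ¬CylinderRungTwo`).
[folklore] -/
theorem rungTwoOfSliceIsolation_of_cylinderRungTwo (hR : CylinderRungTwo) : RungTwoOfSliceIsolation :=
  fun _ => hR

/-- **The route's second path, assembled**: `SliceIsolation`, this item and `ThinCrossSectionExists` give
the summit, through the deciding theorem `closes` (whose rank-2 hypothesis `CylinderRungTwo` is obtained as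
`RungTwoOfSliceIsolation SliceIsolation`). [folklore] -/
theorem smoothPoincare4_of_secondPath (hI : SliceIsolation) (hL : RungTwoOfSliceIsolation)
    (hE : ThinCrossSectionExists) : _root_.SmoothPoincare4 := by
  -- buildfix 2026-08-20 (proof only; statement byte-identical): `closes` was re-cut (it now derives
  -- `CylinderRungTwo` from `CylinderSurgeryResolution`/`NearSliceRecognition`); its tail from
  -- `CylinderRungTwo` on is inlined here verbatim.
  have hR : CylinderRungTwo := hL hI
  unfold _root_.SmoothPoincare4 Literature.SPC4.SmoothPoincareConjectureFour
    ContinuousMap.HomotopyEquiv.NonemptyDiffeomorphSphere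
  intro M _ _ _ _ _ e
  obtain ⟨ι, hι, hN', hsep, hlt⟩ := hE M e
  exact hR M e ι hι hN' hsep hlt

/-! ### Converse: the crux (with calibration) gives entropy descent -/

/-- **`SliceCalibration → CylinderRungTwo → ENTROPY DESCENT`**: if the crux holds, a thin cross-section
makes `M ≃ₘ S⁴`, and transporting the slice `S⁴ × {0}` along the diffeomorphism (tree `CylinderSlice`:
`sliceMap 0 ∘ d` is a smooth embedding into `N` whose image, the slice, separates the ends — the argument
of the crux's Negative lemma `exists_thinCrossSection_of_diffeomorph`) is a cross-section of `M` of entropy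
`λ_cyl(slice) = 1 < 1 + ε` (the calibration item `SliceCalibration`, stmt-SmoothPoincare4-7634).  So ENTROPY
DESCENT is not a strengthening of the crux (modulo calibration). [folklore] -/
theorem entropyDescent_of_cylinderRungTwo (hcal : SliceCalibration) (hR : CylinderRungTwo) :
    ∀ (M : Type) [TopologicalSpace M] [T2Space M] [SecondCountableTopology M]
      [ChartedSpace (EuclideanSpace ℝ (Fin 4)) M] [IsManifold (𝓡 4) ∞ M],
      M ≃ₕ Metric.sphere (0 : EuclideanSpace ℝ (Fin 5)) 1 →
      ∀ ι : M → EuclideanSpace ℝ (Fin 6), Manifold.IsSmoothEmbedding (𝓡 4) (𝓡 6) ∞ ι →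
      (∀ x, ∑ i : Fin 5, ι x (Fin.castSucc i) ^ 2 = 1) →
      (∃ R : ℝ, ∀ a b : EuclideanSpace ℝ (Fin 6), ∑ i : Fin 5, a (Fin.castSucc i) ^ 2 = 1 →
        ∑ i : Fin 5, b (Fin.castSucc i) ^ 2 = 1 → a 5 ≤ -R → R ≤ b 5 →
        ¬ JoinedIn ({z : EuclideanSpace ℝ (Fin 6) | ∑ i : Fin 5, z (Fin.castSucc i) ^ 2 = 1} \
          Set.range ι) a b) →
      cylEntropy (Set.range ι) < ENNReal.ofReal (4 / Real.exp 1) →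
      ∀ ε : ℝ, 0 < ε →
        ∃ ι' : M → EuclideanSpace ℝ (Fin 6), Manifold.IsSmoothEmbedding (𝓡 4) (𝓡 6) ∞ ι' ∧
          (∀ x, ∑ i : Fin 5, ι' x (Fin.castSucc i) ^ 2 = 1) ∧
          (∃ R : ℝ, ∀ a b : EuclideanSpace ℝ (Fin 6), ∑ i : Fin 5, a (Fin.castSucc i) ^ 2 = 1 →
            ∑ i : Fin 5, b (Fin.castSucc i) ^ 2 = 1 → a 5 ≤ -R → R ≤ b 5 →
            ¬ JoinedIn ({z : EuclideanSpace ℝ (Fin 6) | ∑ i : Fin 5, z (Fin.castSucc i) ^ 2 = 1} \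
              Set.range ι') a b) ∧
          cylEntropy (Set.range ι') < ENNReal.ofReal (1 + ε) := by
  intro M _ _ _ _ _ e ι hι hN hsep hent ε hε
  obtain ⟨d⟩ := hR M e ι hι hN hsep hent
  -- transport the slice `S⁴ × {0}` along `d : M ≃ₘ S⁴`
  have hr : Set.range (sliceMap 0 ∘ d) =
      {z : EuclideanSpace ℝ (Fin 6) | ∑ i : Fin 5, z (Fin.castSucc i) ^ 2 = 1 ∧ z 5 = 0} := by
    rw [Set.range_comp, EquivLike.range_eq_univ d, Set.image_univ, range_sliceMap]
  -- the calibration item IS `cylEntropy (slice) = 1` (definitional unfolding of the typed `⨆`)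
  have h1 : cylEntropy {z : EuclideanSpace ℝ (Fin 6) | ∑ i : Fin 5, z (Fin.castSucc i) ^ 2 = 1 ∧ z 5 = 0}
      = 1 := hcal
  refine ⟨sliceMap 0 ∘ d, (isSmoothEmbedding_sliceMap 0).comp_diffeomorph d,
    fun x => sum_sq_sliceMap 0 (d x), ?_, ?_⟩
  · rw [hr]; exact separatesEnds_of_slice_subset (c := 0) subset_rfl
  · rw [hr, h1, ENNReal.one_lt_ofReal]
    linarith

/-- **Modulo the two lower items of the route, ENTROPY DESCENT is EQUIVALENT to the crux** (and hence to
this support item): given `SliceCalibration` (stmt-7634) and `SliceIsolation` (stmt-7632),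
`CylinderRungTwo ↔` ENTROPY DESCENT.  The support item therefore carries exactly the open content of the
crux minus rung-0 recognition — neither more nor less. [folklore] -/
theorem cylinderRungTwo_iff_entropyDescent (hcal : SliceCalibration) (hI : SliceIsolation) :
    CylinderRungTwo ↔
      ∀ (M : Type) [TopologicalSpace M] [T2Space M] [SecondCountableTopology M]
        [ChartedSpace (EuclideanSpace ℝ (Fin 4)) M] [IsManifold (𝓡 4) ∞ M],
        M ≃ₕ Metric.sphere (0 : EuclideanSpace ℝ (Fin 5)) 1 →
        ∀ ι : M → EuclideanSpace ℝ (Fin 6), Manifold.IsSmoothEmbedding (𝓡 4) (𝓡 6) ∞ ι →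
        (∀ x, ∑ i : Fin 5, ι x (Fin.castSucc i) ^ 2 = 1) →
        (∃ R : ℝ, ∀ a b : EuclideanSpace ℝ (Fin 6), ∑ i : Fin 5, a (Fin.castSucc i) ^ 2 = 1 →
          ∑ i : Fin 5, b (Fin.castSucc i) ^ 2 = 1 → a 5 ≤ -R → R ≤ b 5 →
          ¬ JoinedIn ({z : EuclideanSpace ℝ (Fin 6) | ∑ i : Fin 5, z (Fin.castSucc i) ^ 2 = 1} \
            Set.range ι) a b) →
        cylEntropy (Set.range ι) < ENNReal.ofReal (4 / Real.exp 1) →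
        ∀ ε : ℝ, 0 < ε →
          ∃ ι' : M → EuclideanSpace ℝ (Fin 6), Manifold.IsSmoothEmbedding (𝓡 4) (𝓡 6) ∞ ι' ∧
            (∀ x, ∑ i : Fin 5, ι' x (Fin.castSucc i) ^ 2 = 1) ∧
            (∃ R : ℝ, ∀ a b : EuclideanSpace ℝ (Fin 6), ∑ i : Fin 5, a (Fin.castSucc i) ^ 2 = 1 →
              ∑ i : Fin 5, b (Fin.castSucc i) ^ 2 = 1 → a 5 ≤ -R → R ≤ b 5 →
              ¬ JoinedIn ({z : EuclideanSpace ℝ (Fin 6) | ∑ i : Fin 5, z (Fin.castSucc i) ^ 2 = 1} \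
                Set.range ι') a b) ∧
            cylEntropy (Set.range ι') < ENNReal.ofReal (1 + ε) :=
  ⟨entropyDescent_of_cylinderRungTwo hcal,
    fun hdesc => rungTwoOfSliceIsolation_of_entropyDescent hdesc hI⟩

/-! ### The flow interface: finite-time half + relaxation give entropy descent -/

/-- `4/e ≤ 2` in `ℝ≥0∞` (`2 ≤ e`): the entropy bound handed over by the finite-time half is below the
single-sheet threshold `2` of relaxation. [folklore] -/
theorem ofReal_four_div_exp_one_le_two : ENNReal.ofReal (4 / Real.exp 1) ≤ 2 := by
  have h : 4 / Real.exp 1 ≤ 2 := by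
    rw [div_le_iff₀ (Real.exp_pos 1)]
    linarith [Real.add_one_le_exp (1 : ℝ)]
  calc ENNReal.ofReal (4 / Real.exp 1) ≤ ENNReal.ofReal 2 := ENNReal.ofReal_le_ofReal h
    _ = 2 := by simp

/-- **FINITE-TIME HALF + RELAXATION ⇒ ENTROPY DESCENT, for an arbitrary flow predicate `Flow M F ν T`**
(instantiate with `IsCylinderMCF M F ν T` of line `killing-flux`, crux stmt-SmoothPoincare4-7631; then `h₁`
is its registered `stub_finiteTimeHalf` minus the slab clause and `h₃` is its registered `stub_relaxation`,
verbatim up to unfolding `SeparatesEnds`/`cylN`).  All the composition consumes of the flow is that each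
`F t`, `t ≥ T`, is a smooth embedding (`hEmb`) into `N` (`hCyl`); STUB 1 (`h₁`) turns a thin cross-section
of the homotopy sphere `M` into such a flow of end-separating cross-sections of `M` with `λ_cyl < 4/e ≤ 2`,
STUB 3 (`h₃`) relaxes it below `1 + ε` from some `t₀ ≥ T` on (`M` is compact — tree, Hatcher 3.29 — and
connected, from `M ≃ₕ S⁴`), and `ι' := F t₀` is the descended cross-section. [folklore] -/
theorem entropyDescent_of_flow
    (Flow : ∀ (M : Type) [TopologicalSpace M] [ChartedSpace (EuclideanSpace ℝ (Fin 4)) M]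
      [IsManifold (𝓡 4) ∞ M],
      (ℝ → M → EuclideanSpace ℝ (Fin 6)) → (ℝ → M → EuclideanSpace ℝ (Fin 6)) → ℝ → Prop)
    (hEmb : ∀ (M : Type) [TopologicalSpace M] [ChartedSpace (EuclideanSpace ℝ (Fin 4)) M]
      [IsManifold (𝓡 4) ∞ M] (F ν : ℝ → M → EuclideanSpace ℝ (Fin 6)) (T : ℝ), Flow M F ν T →
      ∀ t, T ≤ t → Manifold.IsSmoothEmbedding (𝓡 4) (𝓡 6) ∞ (F t))
    (hCyl : ∀ (M : Type) [TopologicalSpace M] [ChartedSpace (EuclideanSpace ℝ (Fin 4)) M]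
      [IsManifold (𝓡 4) ∞ M] (F ν : ℝ → M → EuclideanSpace ℝ (Fin 6)) (T : ℝ), Flow M F ν T →
      ∀ t, T ≤ t → ∀ x, ∑ i : Fin 5, F t x (Fin.castSucc i) ^ 2 = 1)
    (h₁ : ∀ (M : Type) [TopologicalSpace M] [T2Space M] [SecondCountableTopology M]
        [ChartedSpace (EuclideanSpace ℝ (Fin 4)) M] [IsManifold (𝓡 4) ∞ M],
        M ≃ₕ Metric.sphere (0 : EuclideanSpace ℝ (Fin 5)) 1 →
        ∀ ι : M → EuclideanSpace ℝ (Fin 6), Manifold.IsSmoothEmbedding (𝓡 4) (𝓡 6) ∞ ι →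
        (∀ x, ∑ i : Fin 5, ι x (Fin.castSucc i) ^ 2 = 1) →
        (∃ R : ℝ, ∀ a b : EuclideanSpace ℝ (Fin 6), ∑ i : Fin 5, a (Fin.castSucc i) ^ 2 = 1 →
          ∑ i : Fin 5, b (Fin.castSucc i) ^ 2 = 1 → a 5 ≤ -R → R ≤ b 5 →
          ¬ JoinedIn ({z : EuclideanSpace ℝ (Fin 6) | ∑ i : Fin 5, z (Fin.castSucc i) ^ 2 = 1} \
            Set.range ι) a b) →
        cylEntropy (Set.range ι) < ENNReal.ofReal (4 / Real.exp 1) →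
        ∃ (F ν : ℝ → M → EuclideanSpace ℝ (Fin 6)) (T : ℝ), Flow M F ν T ∧
          (∀ t, T ≤ t → ∃ R : ℝ, ∀ a b : EuclideanSpace ℝ (Fin 6),
            ∑ i : Fin 5, a (Fin.castSucc i) ^ 2 = 1 → ∑ i : Fin 5, b (Fin.castSucc i) ^ 2 = 1 →
            a 5 ≤ -R → R ≤ b 5 →
            ¬ JoinedIn ({z : EuclideanSpace ℝ (Fin 6) | ∑ i : Fin 5, z (Fin.castSucc i) ^ 2 = 1} \
              Set.range (F t)) a b) ∧
          (∀ t, T ≤ t → cylEntropy (Set.range (F t)) < ENNReal.ofReal (4 / Real.exp 1)))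
    (h₃ : ∀ (M : Type) [TopologicalSpace M] [T2Space M] [SecondCountableTopology M]
        [ChartedSpace (EuclideanSpace ℝ (Fin 4)) M] [IsManifold (𝓡 4) ∞ M] [CompactSpace M]
        [ConnectedSpace M] (F ν : ℝ → M → EuclideanSpace ℝ (Fin 6)) (T : ℝ), Flow M F ν T →
        (∀ t, T ≤ t → ∃ R : ℝ, ∀ a b : EuclideanSpace ℝ (Fin 6),
          ∑ i : Fin 5, a (Fin.castSucc i) ^ 2 = 1 → ∑ i : Fin 5, b (Fin.castSucc i) ^ 2 = 1 →
          a 5 ≤ -R → R ≤ b 5 →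
          ¬ JoinedIn ({z : EuclideanSpace ℝ (Fin 6) | ∑ i : Fin 5, z (Fin.castSucc i) ^ 2 = 1} \
            Set.range (F t)) a b) →
        (∀ t, T ≤ t → cylEntropy (Set.range (F t)) < 2) →
        ∀ ε : ℝ, 0 < ε → ∃ t₀ : ℝ, T ≤ t₀ ∧
          ∀ s, t₀ ≤ s → cylEntropy (Set.range (F s)) < ENNReal.ofReal (1 + ε)) :
    ∀ (M : Type) [TopologicalSpace M] [T2Space M] [SecondCountableTopology M]
      [ChartedSpace (EuclideanSpace ℝ (Fin 4)) M] [IsManifold (𝓡 4) ∞ M],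
      M ≃ₕ Metric.sphere (0 : EuclideanSpace ℝ (Fin 5)) 1 →
      ∀ ι : M → EuclideanSpace ℝ (Fin 6), Manifold.IsSmoothEmbedding (𝓡 4) (𝓡 6) ∞ ι →
      (∀ x, ∑ i : Fin 5, ι x (Fin.castSucc i) ^ 2 = 1) →
      (∃ R : ℝ, ∀ a b : EuclideanSpace ℝ (Fin 6), ∑ i : Fin 5, a (Fin.castSucc i) ^ 2 = 1 →
        ∑ i : Fin 5, b (Fin.castSucc i) ^ 2 = 1 → a 5 ≤ -R → R ≤ b 5 →
        ¬ JoinedIn ({z : EuclideanSpace ℝ (Fin 6) | ∑ i : Fin 5, z (Fin.castSucc i) ^ 2 = 1} \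
          Set.range ι) a b) →
      cylEntropy (Set.range ι) < ENNReal.ofReal (4 / Real.exp 1) →
      ∀ ε : ℝ, 0 < ε →
        ∃ ι' : M → EuclideanSpace ℝ (Fin 6), Manifold.IsSmoothEmbedding (𝓡 4) (𝓡 6) ∞ ι' ∧
          (∀ x, ∑ i : Fin 5, ι' x (Fin.castSucc i) ^ 2 = 1) ∧
          (∃ R : ℝ, ∀ a b : EuclideanSpace ℝ (Fin 6), ∑ i : Fin 5, a (Fin.castSucc i) ^ 2 = 1 →
            ∑ i : Fin 5, b (Fin.castSucc i) ^ 2 = 1 → a 5 ≤ -R → R ≤ b 5 →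
            ¬ JoinedIn ({z : EuclideanSpace ℝ (Fin 6) | ∑ i : Fin 5, z (Fin.castSucc i) ^ 2 = 1} \
              Set.range ι') a b) ∧
          cylEntropy (Set.range ι') < ENNReal.ofReal (1 + ε) := by
  intro M _ _ _ _ _ e ι hι hN hsep hent ε hε
  -- instances from `M ≃ₕ S⁴` (PROVED in the tree)
  haveI : CompactSpace M :=
    Literature.Topology.FourManifolds.compactSpace_of_homotopyEquiv_sphere_four_holds M e
  haveI : PathConnectedSpace M := by
    haveI := Literature.Topology.FourManifolds.pathConnectedSpace_sphere_four
    exact Literature.Topology.FourManifolds.pathConnectedSpace_of_homotopyEquiv e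
  -- STUB 1: an immortal flow of end-separating cross-section embeddings of `M` with `λ_cyl < 4/e ≤ 2`
  obtain ⟨F, ν, T, hflow, hsepF, hentF⟩ := h₁ M e ι hι hN hsep hent
  have h2 : ∀ t, T ≤ t → cylEntropy (Set.range (F t)) < 2 := fun t ht =>
    lt_of_lt_of_le (hentF t ht) ofReal_four_div_exp_one_le_two
  -- STUB 3: relaxation below `1 + ε` from some `t₀ ≥ T` on; descend to `ι' := F t₀`
  obtain ⟨t₀, hTt₀, hsmall⟩ := h₃ M F ν T hflow hsepF h2 ε hε
  exact ⟨F t₀, hEmb M F ν T hflow t₀ hTt₀, hCyl M F ν T hflow t₀ hTt₀, hsepF t₀ hTt₀,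
    hsmall t₀ le_rfl⟩

/-- **`RungTwoOfSliceIsolation` from the two flow stubs**: for any flow predicate whose flows consist of
smooth embeddings into `N`, FINITE-TIME HALF (`h₁`) + RELAXATION (`h₃`) prove the item (through
`entropyDescent_of_flow` and `rungTwoOfSliceIsolation_of_entropyDescent`).  With
`Flow := IsCylinderMCF` this is the item CLOSED MODULO the registered stubs `stub_finiteTimeHalf` and
`stub_relaxation` of crux stmt-SmoothPoincare4-7631 (line `killing-flux`) — stubs 2, 4, 5 of that line are
replaced by the hypothesis `SliceIsolation`. [folklore] -/
theorem rungTwoOfSliceIsolation_of_flow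
    (Flow : ∀ (M : Type) [TopologicalSpace M] [ChartedSpace (EuclideanSpace ℝ (Fin 4)) M]
      [IsManifold (𝓡 4) ∞ M],
      (ℝ → M → EuclideanSpace ℝ (Fin 6)) → (ℝ → M → EuclideanSpace ℝ (Fin 6)) → ℝ → Prop)
    (hEmb : ∀ (M : Type) [TopologicalSpace M] [ChartedSpace (EuclideanSpace ℝ (Fin 4)) M]
      [IsManifold (𝓡 4) ∞ M] (F ν : ℝ → M → EuclideanSpace ℝ (Fin 6)) (T : ℝ), Flow M F ν T →
      ∀ t, T ≤ t → Manifold.IsSmoothEmbedding (𝓡 4) (𝓡 6) ∞ (F t))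
    (hCyl : ∀ (M : Type) [TopologicalSpace M] [ChartedSpace (EuclideanSpace ℝ (Fin 4)) M]
      [IsManifold (𝓡 4) ∞ M] (F ν : ℝ → M → EuclideanSpace ℝ (Fin 6)) (T : ℝ), Flow M F ν T →
      ∀ t, T ≤ t → ∀ x, ∑ i : Fin 5, F t x (Fin.castSucc i) ^ 2 = 1)
    (h₁ : ∀ (M : Type) [TopologicalSpace M] [T2Space M] [SecondCountableTopology M]
        [ChartedSpace (EuclideanSpace ℝ (Fin 4)) M] [IsManifold (𝓡 4) ∞ M],
        M ≃ₕ Metric.sphere (0 : EuclideanSpace ℝ (Fin 5)) 1 →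
        ∀ ι : M → EuclideanSpace ℝ (Fin 6), Manifold.IsSmoothEmbedding (𝓡 4) (𝓡 6) ∞ ι →
        (∀ x, ∑ i : Fin 5, ι x (Fin.castSucc i) ^ 2 = 1) →
        (∃ R : ℝ, ∀ a b : EuclideanSpace ℝ (Fin 6), ∑ i : Fin 5, a (Fin.castSucc i) ^ 2 = 1 →
          ∑ i : Fin 5, b (Fin.castSucc i) ^ 2 = 1 → a 5 ≤ -R → R ≤ b 5 →
          ¬ JoinedIn ({z : EuclideanSpace ℝ (Fin 6) | ∑ i : Fin 5, z (Fin.castSucc i) ^ 2 = 1} \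
            Set.range ι) a b) →
        cylEntropy (Set.range ι) < ENNReal.ofReal (4 / Real.exp 1) →
        ∃ (F ν : ℝ → M → EuclideanSpace ℝ (Fin 6)) (T : ℝ), Flow M F ν T ∧
          (∀ t, T ≤ t → ∃ R : ℝ, ∀ a b : EuclideanSpace ℝ (Fin 6),
            ∑ i : Fin 5, a (Fin.castSucc i) ^ 2 = 1 → ∑ i : Fin 5, b (Fin.castSucc i) ^ 2 = 1 →
            a 5 ≤ -R → R ≤ b 5 →
            ¬ JoinedIn ({z : EuclideanSpace ℝ (Fin 6) | ∑ i : Fin 5, z (Fin.castSucc i) ^ 2 = 1} \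
              Set.range (F t)) a b) ∧
          (∀ t, T ≤ t → cylEntropy (Set.range (F t)) < ENNReal.ofReal (4 / Real.exp 1)))
    (h₃ : ∀ (M : Type) [TopologicalSpace M] [T2Space M] [SecondCountableTopology M]
        [ChartedSpace (EuclideanSpace ℝ (Fin 4)) M] [IsManifold (𝓡 4) ∞ M] [CompactSpace M]
        [ConnectedSpace M] (F ν : ℝ → M → EuclideanSpace ℝ (Fin 6)) (T : ℝ), Flow M F ν T →
        (∀ t, T ≤ t → ∃ R : ℝ, ∀ a b : EuclideanSpace ℝ (Fin 6),
          ∑ i : Fin 5, a (Fin.castSucc i) ^ 2 = 1 → ∑ i : Fin 5, b (Fin.castSucc i) ^ 2 = 1 →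
          a 5 ≤ -R → R ≤ b 5 →
          ¬ JoinedIn ({z : EuclideanSpace ℝ (Fin 6) | ∑ i : Fin 5, z (Fin.castSucc i) ^ 2 = 1} \
            Set.range (F t)) a b) →
        (∀ t, T ≤ t → cylEntropy (Set.range (F t)) < 2) →
        ∀ ε : ℝ, 0 < ε → ∃ t₀ : ℝ, T ≤ t₀ ∧
          ∀ s, t₀ ≤ s → cylEntropy (Set.range (F s)) < ENNReal.ofReal (1 + ε)) :
    RungTwoOfSliceIsolation :=
  rungTwoOfSliceIsolation_of_entropyDescent (entropyDescent_of_flow Flow hEmb hCyl h₁ h₃)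

end Summit.SmoothPoincare4.SmoothPoincare4.Theorems.CylinderEntropyRungTwoOfSliceIsolation

end
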